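import Summits.Ventures.PercRepro.C041InvStar

/-!
# LEMMA (INV-STAR), the closed form of the left side (p6, gen 25; C-041.md §10 (f))

In the abstract star model of `C041InvStar`, the admissible invalid states with `¬ρ_t` are counted exactly:

  **`card_Lset`**: `#{adm ∧ invalid ∧ ¬ρ_t} = Σ_A s_A · (2^{k_t(Ā)} − 1)`,

`A` the set of open leaves, `s_A = ∏_{i ∈ A} s_i` with `s_i = [k_t(i) = 0 ∨ k_j(i) = 0]` (the leaf is single-typed),
`k_t(Ā) = Σ_{i ∉ A} k_t(i)` — the paper's `L = Σ_A s_A (2^{k_t(Ā)} − 1)`.  Per `A` (`card_Lfiber`): the states are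
exactly those with every edge at an open leaf blue, every open leaf single-typed, every `j`-edge at a closed leaf
red and some `t`-edge at a closed leaf blue (`mem_Lfiber_iff`); for a single-typed `A` they are the colourings of the
`t`-edges that are blue on `A` and not all red off `A` (`2^{k_t(Ā)} − 1`, a `piFinset` count minus the all-red
one), otherwise there are none.
-/

namespace PercRepro

namespace InvStar

open Finset

variable {ι : Type*} [Fintype ι] [DecidableEq ι] (kt ko : ι → ℕ)

/-- `s_i = [k_t(i) = 0 ∨ k_j(i) = 0]`: the leaf is single-typed. -/
def sBit (i : ι) : ℕ := if kt i = 0 ∨ ko i = 0 then 1 else 0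

/-- `s_A = ∏_{i ∈ A} s_i`. -/
def sProd (A : Finset ι) : ℕ := ∏ i ∈ A, sBit kt ko i

/-- `k_t(Ā) = Σ_{i ∉ A} k_t(i)`. -/
def ktBar (A : Finset ι) : ℕ := ∑ i ∈ Aᶜ, kt i

open Classical in
/-- The left side of (INV): the admissible invalid states with `¬ρ_t`. -/
noncomputable def Lset : Finset (StarState ι kt ko) :=
  univ.filter fun s => AdmS s ∧ InvalidS s ∧ ¬ RhoS s

open Classical in
/-- The fibre of the left side over the open set `A`. -/
noncomputable def Lfiber (A : Finset ι) : Finset (StarState ι kt ko) :=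
  (Lset kt ko).filter fun s => s.1 = A

/-- The all-blue `j`-colouring on `A`, all-red off `A`. -/
def oOf (A : Finset ι) : (i : ι) → Fin (ko i) → Bool := fun i _ => decide (i ∉ A)

/-- The all-blue `t`-colouring on `A`, all-red off `A`. -/
def tOf (A : Finset ι) : (i : ι) → Fin (kt i) → Bool := fun i _ => decide (i ∉ A)

/-- A leaf with an edge of each type is not single-typed; conversely a single-typed leaf has no edge of one type. -/
theorem exists_fin_iff (k : ℕ) : (∃ _ : Fin k, True) ↔ k ≠ 0 := by
  constructor
  · rintro ⟨e, _⟩ hk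
    exact absurd e.2 (by omega)
  · intro hk
    exact ⟨⟨0, Nat.pos_of_ne_zero hk⟩, trivial⟩

omit [Fintype ι] [DecidableEq ι] in
/-- **The fibre, characterised**: `s` is in the left side with open set `A` iff every edge at an open leaf is blue,
every open leaf is single-typed, every `j`-edge at a closed leaf is red and some `t`-edge at a closed leaf is
blue. -/
theorem mem_Lfiber_iff' (A : Finset ι) (s : StarState ι kt ko) :
    (AdmS s ∧ InvalidS s ∧ ¬ RhoS s) ∧ s.1 = A ↔
      s.1 = A ∧ (∀ i ∈ A, kt i = 0 ∨ ko i = 0) ∧ (∀ i ∈ A, ∀ e, s.2.1 i e = false) ∧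
        (∀ i ∈ A, ∀ e, s.2.2 i e = false) ∧ (∀ i, i ∉ A → ∀ e, s.2.2 i e = true) ∧
        ¬ (∀ i, i ∉ A → ∀ e, s.2.1 i e = true) := by
  constructor
  · rintro ⟨⟨hadm, hinv, hρ⟩, hA⟩
    subst hA
    refine ⟨rfl, fun i hi => ?_, fun i hi => (hinv i hi).1, fun i hi => (hinv i hi).2,
      closed_o_red hadm hρ, hρ⟩
    by_contra h
    rw [not_or] at h
    apply hadm.1 i hi
    refine ⟨⟨⟨0, Nat.pos_of_ne_zero h.1⟩, (hinv i hi).1 _⟩, ⟨⟨0, Nat.pos_of_ne_zero h.2⟩, (hinv i hi).2 _⟩⟩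
  · rintro ⟨hA, hs, ht, ho, hored, hρ⟩
    subst hA
    refine ⟨⟨⟨fun i hi => ?_, fun h => ?_⟩, fun i hi => ⟨ht i hi, ho i hi⟩, hρ⟩, rfl⟩
    · rintro ⟨⟨e, _⟩, ⟨f, _⟩⟩
      rcases hs i hi with h0 | h0
      · exact absurd e.2 (by omega)
      · exact absurd f.2 (by omega)
    · obtain ⟨_, i, hi, e, he⟩ := h
      rw [hored i hi e] at he
      exact Bool.noConfusion he

open Classical in
/-- Membership in the fibre. -/
theorem mem_Lfiber_iff (A : Finset ι) (s : StarState ι kt ko) :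
    s ∈ Lfiber kt ko A ↔
      s.1 = A ∧ (∀ i ∈ A, kt i = 0 ∨ ko i = 0) ∧ (∀ i ∈ A, ∀ e, s.2.1 i e = false) ∧
        (∀ i ∈ A, ∀ e, s.2.2 i e = false) ∧ (∀ i, i ∉ A → ∀ e, s.2.2 i e = true) ∧
        ¬ (∀ i, i ∉ A → ∀ e, s.2.1 i e = true) := by
  unfold Lfiber Lset
  rw [Finset.mem_filter, Finset.mem_filter]
  simp only [Finset.mem_univ, true_and]
  exact mem_Lfiber_iff' kt ko A s

open Classical in
/-- The `t`-colourings that are blue on `A`. -/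
noncomputable def T₀ (A : Finset ι) : Finset ((i : ι) → Fin (kt i) → Bool) :=
  Fintype.piFinset fun i => if i ∈ A then ({fun _ => false} : Finset (Fin (kt i) → Bool)) else univ

omit [DecidableEq ι] in
/-- The cardinality of the colourings of `Fin k → Bool`. -/
theorem card_fun_bool (k : ℕ) : (univ : Finset (Fin k → Bool)).card = 2 ^ k := by
  rw [Finset.card_univ, Fintype.card_fun, Fintype.card_bool, Fintype.card_fin]

open Classical in
/-- Membership in `T₀`. -/
theorem mem_T₀ (A : Finset ι) (g : (i : ι) → Fin (kt i) → Bool) :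
    g ∈ T₀ kt A ↔ ∀ i ∈ A, ∀ e, g i e = false := by
  unfold T₀
  rw [Fintype.mem_piFinset]
  constructor
  · intro h i hi e
    have := h i
    rw [if_pos hi, Finset.mem_singleton] at this
    rw [this]
  · intro h i
    by_cases hi : i ∈ A
    · rw [if_pos hi, Finset.mem_singleton]
      funext e
      exact h i hi e
    · rw [if_neg hi]
      exact Finset.mem_univ _

open Classical in
/-- `#T₀ = 2^{k_t(Ā)}`. -/
theorem card_T₀ (A : Finset ι) : (T₀ kt A).card = 2 ^ ktBar kt A := by
  unfold T₀ ktBar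
  rw [Fintype.card_piFinset]
  have h : ∀ i, (if i ∈ A then ({fun _ => false} : Finset (Fin (kt i) → Bool)) else univ).card
      = if i ∈ Aᶜ then 2 ^ kt i else 1 := by
    intro i
    by_cases hi : i ∈ A
    · rw [if_pos hi, if_neg (by simpa using hi), Finset.card_singleton]
    · rw [if_neg hi, if_pos (by simpa using hi), card_fun_bool]
  rw [Finset.prod_congr rfl fun i _ => h i, Finset.prod_ite_mem, Finset.univ_inter,
    Finset.prod_pow_eq_pow_sum]

open Classical in
/-- The all-red-off-`A` colouring is the only element of `T₀` that is red off `A`. -/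
theorem T₀_filter_allRed (A : Finset ι) :
    (T₀ kt A).filter (fun g => ∀ i, i ∉ A → ∀ e, g i e = true) = {tOf kt A} := by
  ext g
  rw [Finset.mem_filter, mem_T₀, Finset.mem_singleton]
  constructor
  · rintro ⟨h1, h2⟩
    funext i e
    unfold tOf
    by_cases hi : i ∈ A
    · rw [h1 i hi e]
      simp [hi]
    · rw [h2 i hi e]
      simp [hi]
  · rintro rfl
    unfold tOf
    exact ⟨fun i hi _ => by simp [hi], fun i hi _ => by simp [hi]⟩

open Classical in
/-- `#{g ∈ T₀ : not all red off A} = 2^{k_t(Ā)} − 1`. -/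
theorem card_T₀_notAllRed (A : Finset ι) :
    ((T₀ kt A).filter (fun g => ¬ ∀ i, i ∉ A → ∀ e, g i e = true)).card = 2 ^ ktBar kt A - 1 := by
  have h := Finset.card_filter_add_card_filter_not (s := T₀ kt A)
    (p := fun g => ∀ i, i ∉ A → ∀ e, g i e = true)
  rw [T₀_filter_allRed, Finset.card_singleton, card_T₀] at h
  omega

open Classical in
/-- The fibre is the image of the `t`-colourings blue on `A` and not all red off `A` (single-typed `A`). -/
theorem Lfiber_eq_image (A : Finset ι) (hs : ∀ i ∈ A, kt i = 0 ∨ ko i = 0) :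
    Lfiber kt ko A = ((T₀ kt A).filter (fun g => ¬ ∀ i, i ∉ A → ∀ e, g i e = true)).image
      (fun g => ((A, g, oOf ko A) : StarState ι kt ko)) := by
  ext s
  rw [mem_Lfiber_iff, Finset.mem_image]
  constructor
  · rintro ⟨hA, _, ht, ho, hored, hρ⟩
    refine ⟨s.2.1, ?_, ?_⟩
    · rw [Finset.mem_filter, mem_T₀]
      exact ⟨fun i hi e => ht i (hA ▸ hi) e, fun h => hρ fun i hi e => h i (hA ▸ hi) e⟩
    · obtain ⟨A', t, o⟩ := s
      simp only at hA ht ho hored ⊢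
      subst hA
      congr
      funext i e
      unfold oOf
      by_cases hi : i ∈ A'
      · rw [ho i hi e]
        simp [hi]
      · rw [hored i hi e]
        simp [hi]
  · rintro ⟨g, hg, rfl⟩
    rw [Finset.mem_filter, mem_T₀] at hg
    refine ⟨rfl, hs, hg.1, fun i hi _ => ?_, fun i hi _ => ?_, hg.2⟩
    · unfold oOf
      simp [hi]
    · unfold oOf
      simp [hi]

open Classical in
/-- The fibre is empty unless every open leaf is single-typed. -/
theorem Lfiber_eq_empty (A : Finset ι) (hs : ¬ ∀ i ∈ A, kt i = 0 ∨ ko i = 0) :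
    Lfiber kt ko A = ∅ := by
  rw [Finset.eq_empty_iff_forall_notMem]
  intro s hsA
  rw [mem_Lfiber_iff] at hsA
  exact hs hsA.2.1

/-- `s_A = 1` iff every open leaf is single-typed, else `0`. -/
theorem sProd_eq (A : Finset ι) :
    sProd kt ko A = if (∀ i ∈ A, kt i = 0 ∨ ko i = 0) then 1 else 0 := by
  unfold sProd sBit
  by_cases h : ∀ i ∈ A, kt i = 0 ∨ ko i = 0
  · rw [if_pos h]
    exact Finset.prod_eq_one fun i hi => by rw [if_pos (h i hi)]
  · rw [if_neg h]
    obtain ⟨i, hi⟩ := not_forall.1 h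
    obtain ⟨hiA, hi'⟩ := Classical.not_imp.1 hi
    exact Finset.prod_eq_zero hiA (by rw [if_neg hi'])

open Classical in
/-- **The fibre count**: `#Lfiber(A) = s_A · (2^{k_t(Ā)} − 1)`. -/
theorem card_Lfiber (A : Finset ι) : (Lfiber kt ko A).card = sProd kt ko A * (2 ^ ktBar kt A - 1) := by
  rw [sProd_eq]
  by_cases hs : ∀ i ∈ A, kt i = 0 ∨ ko i = 0
  · rw [if_pos hs, one_mul, Lfiber_eq_image kt ko A hs, Finset.card_image_of_injective, card_T₀_notAllRed]
    intro g g' h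
    exact congrArg (fun s : StarState ι kt ko => s.2.1) h
  · rw [if_neg hs, zero_mul, Lfiber_eq_empty kt ko A hs, Finset.card_empty]

open Classical in
/-- **THE CLOSED FORM OF THE LEFT SIDE** (C-041.md §10 (f)): `#{adm ∧ invalid ∧ ¬ρ_t} = Σ_A s_A (2^{k_t(Ā)} − 1)`. -/
theorem card_Lset : (Lset kt ko).card = ∑ A : Finset ι, sProd kt ko A * (2 ^ ktBar kt A - 1) := by
  rw [Finset.card_eq_sum_card_fiberwise (f := fun s : StarState ι kt ko => s.1) (t := univ)
    (fun _ _ => Finset.mem_univ _)]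
  apply Finset.sum_congr rfl
  intro A _
  exact card_Lfiber kt ko A

end InvStar

end PercRepro
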